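import Summits.BirchSwinnertonDyer.BirchSwinnertonDyer.Theorems.GenusKolyvaginAtTwoGenusPrimitiveSupplyAtTwoTwistNormLemma210v
import Literature.NumberTheory.EllipticCurves.KramerTunnell1982.UnramifiedNormIndex
import HarnessLib

/-!
# Route `GenusKolyvaginAtTwo`, crux #2 `GenusPrimitiveSupplyAtTwo` (stmt-BirchSwinnertonDyer-22136):
# GALOIS DESCENT FOR THE NORM-SURJECTIVITY INPUT `hnorm` — from Kramer–Tunnell's `[E(K')^σ : N E(K')] = 1`
# on `K'`-rational points to «every `Γ_E`-fixed point of `E(K̄_E)` is a norm `Q + τ₀Q`»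

Width seat `bsd-line-gk2-p5` g11 (cell `bsd-f1-sign2`, SUPPLY lineage), file 37 of the series (sequel of
`…TwistNormLemma210v.lean` p646371, `…TwistDyadicUnramifiedSqrt.lean` p647476). THEOREMS ONLY (no definition, no named
fact, no `sorry`, no local instance); helper `--supports stmt-BirchSwinnertonDyer-22136`; no item is closed; BSD is not proved
by any of this.

WHAT. The engine `GenusKolyArch.map_kummerLocalConditionAt_adicCompletion_eq_of_forall_exists_norm` (Mazur–Rubin Lemma 2.10 (v)
SHAPE at a finite place) displays ONE hypothesis `hnorm`: every `Γ_E`-fixed point `P` of `W(K̄_E)` is `Q + τ₀Q` with `Q` fixed by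
the index-`2` subgroup `{σ : σ ι√d = ι√d}` and `τ₀` flipping `ι√d`. The tree's local norm-index theorems (Mazur 1972 / Kramer–Tunnell
1982 Lemma 6.1 type `I₀`: `KramerTunnell1982.relIndex_normSubgroup_fixedSubgroup_eq_one_of_isUnit_Δ`; Kramer 1981 Props. 1, 2 (a):
`Kramer1981.props1_2a_multiplicativeNormIndex_holds`) live in ANOTHER currency: points of `V.baseChange K'` for an intermediate field
`K' ⊆ F̄` quadratic over the local field `F`, `σ ∈ Aut(K'/F)`, and the subgroups `fixedSubgroup V K' σ = V(K')^σ`,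
`normSubgroup V K' σ = {P + σP}`. This file is the bridge (memo `Lines/genus-supply-mr-instantiation.md` §8b (c)):

* §87 (any field `F`, any `V/F`, any intermediate field `K' ⊆ F̄`, any `σ ∈ Aut(K'/F)`): `smul_map_val_eq_of_forall_apply`
  (an element `g ∈ Γ_F` restricting to `σ` on `K'` acts on `ι_{K'} P` as `ι_{K'}(σP)`), `smul_map_val_eq_self_of_forall_apply`,
  **`exists_fixed_norm_eq_of_fixedSubgroup_le_normSubgroup`** — if `V(K')^σ ⊆ N V(K')` (relative index `1`) and `τ₀ ∈ Γ_F`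
  restricts to `σ`, then every `Γ_F`-fixed `P ∈ V(F̄)` is `Q + τ₀Q` with `Q` fixed by every `g` that is the identity on `K'`
  (Galois descent `V(F̄)^{Γ_F} = V(F)`, `F` perfect, tree `exists_toGeomPoints_eq_of_forall_smul_eq`);
* §88 (the series' currency: `W/K`, a `K`-field `E`, `localPoints W E = W(K̄_E)`, `α = closureEmb E (geomSqrt d)`):
  `forall_apply_eq_of_apply_adjoin_gen_eq` (`g α = α ⟹ g` is the identity on `(IntermediateField.adjoin E {α})`), `apply_eq_of_restrictNormal`
  and **`forall_exists_norm_of_fixedSubgroup_le_normSubgroup`** — `hnorm` VERBATIM as displayed by the engine, from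
  `fixedSubgroup (W.baseChange E) (IntermediateField.adjoin E {α}) σ ≤ normSubgroup (W.baseChange E) (IntermediateField.adjoin E {α}) σ` for ANY `σ ∈ Aut((IntermediateField.adjoin E {α})/E)` with `σ α = −α`
  and any `τ₀ ∈ Γ_E` flipping `α` (transport along the `Γ_E`-equivariant `baseChangeGeomPointsEquiv`).

The norm-index inputs themselves (good reduction + `E(√d)/E` unramified; multiplicative reduction with `ord Δ` odd) are fed in the
sequel files; nothing here depends on reduction types or on `K` being a number field.

References: [MazurRubin2010] Lemma 2.9, Lemma 2.10 (iii), (v) and their proofs («`E_N(K_v) = E(K_v)`»); [Kramer1981] Prop. 7;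
[KramerTunnell1982] §5 proof of Prop. 5.11 (`E(F)/NE(K) ≅ Ĥ⁰(G, E(K))`); [SilvermanAEC2009] VIII.§1 (Galois descent for points).
-/

set_option linter.dupNamespace false -- tree convention: `Summit.BirchSwinnertonDyer.BirchSwinnertonDyer.Theorems` (summit = sub-problem)
set_option autoImplicit false

noncomputable section

open scoped Classical

namespace Summit.BirchSwinnertonDyer.BirchSwinnertonDyer.Theorems.GenusKolyArch

open WeierstrassCurve Field Function
open Literature.NumberTheory.EllipticCurves Literature.NumberTheory.GaloisRepresentations
open Literature.NumberTheory.EllipticCurves.KramerTunnell1982 (normSubgroup fixedSubgroup mem_normSubgroup_iff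
  mem_fixedSubgroup_iff)

universe u

/-! ## §87 Norms on `K'`-points versus norms on geometric points (any field) -/

section Field

variable {F : Type u} [Field F] (V : WeierstrassCurve F) (K' : IntermediateField F (AlgebraicClosure F))

/-- **An element of `Γ_F` restricting to `σ ∈ Aut(K'/F)` acts on `K'`-points through `σ`:** `g • ι P = ι (σ P)` for the
inclusion `ι = Affine.Point.map K'.val : V(K') → V(F̄)` (both sides are `Affine.Point.map` of the same embedding `K' → F̄`).
[cite: SilvermanAEC2009, VIII.§1 (the Galois action on points)] -/
theorem smul_map_val_eq_of_forall_apply (g : absoluteGaloisGroup F) (σ : K' ≃ₐ[F] K')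
    (hg : ∀ x : K', (show AlgebraicClosure F ≃ₐ[F] AlgebraicClosure F from g) (x : AlgebraicClosure F) =
      ((σ x : K') : AlgebraicClosure F))
    (P : (V.baseChange K').toAffine.Point) :
    Affine.Point.map (W' := V)
        ((show AlgebraicClosure F ≃ₐ[F] AlgebraicClosure F from g) : AlgebraicClosure F →ₐ[F] AlgebraicClosure F)
        (Affine.Point.map (W' := V) (IntermediateField.val K') P) =
      Affine.Point.map (W' := V) (IntermediateField.val K') (Affine.Point.map (W' := V) (σ : K' →ₐ[F] K') P) := by
  have key : ((show AlgebraicClosure F ≃ₐ[F] AlgebraicClosure F from g) : AlgebraicClosure F →ₐ[F] AlgebraicClosure F).comp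
      (IntermediateField.val K') = (IntermediateField.val K').comp (σ : K' →ₐ[F] K') := by
    ext x
    exact hg x
  rw [Affine.Point.map_map, Affine.Point.map_map, key]

/-- **An element of `Γ_F` that is the identity on `K'` fixes the `K'`-points.** [cite: SilvermanAEC2009, VIII.§1] -/
theorem smul_map_val_eq_self_of_forall_apply (g : absoluteGaloisGroup F)
    (hg : ∀ x : K', (show AlgebraicClosure F ≃ₐ[F] AlgebraicClosure F from g) (x : AlgebraicClosure F) = x)
    (P : (V.baseChange K').toAffine.Point) :
    Affine.Point.map (W' := V)
        ((show AlgebraicClosure F ≃ₐ[F] AlgebraicClosure F from g) : AlgebraicClosure F →ₐ[F] AlgebraicClosure F)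
        (Affine.Point.map (W' := V) (IntermediateField.val K') P) =
      Affine.Point.map (W' := V) (IntermediateField.val K') P := by
  rw [smul_map_val_eq_of_forall_apply V K' g 1 (fun x ↦ by rw [AlgEquiv.one_apply]; exact hg x) P]
  congr 1
  change Affine.Point.map (W' := V) (Algebra.ofId K' K') P = P
  exact Affine.Point.map_id P

/-- The inclusion of `K'`-points followed over `F`-points: `ι_{K'} (P₀ ⊗ K') = ι_F P₀` (`Affine.Point.map_baseChange`). [folklore] -/
theorem map_val_baseChange_eq_toGeomPoints (P₀ : V.toAffine.Point) :
    Affine.Point.map (W' := V) (IntermediateField.val K') (Affine.Point.baseChange (W' := V) F K' P₀) =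
      toGeomPoints V P₀ :=
  Affine.Point.map_baseChange (W' := V) (IntermediateField.val K') P₀

/-- **From `V(K')^σ ⊆ N V(K')` to norms on geometric points.** `F` perfect, `K' ⊆ F̄` an intermediate field with an
`F`-automorphism `σ`, `τ₀ ∈ Γ_F` restricting to `σ` on `K'`. If every `σ`-fixed `K'`-point is a norm `Q₁ + σQ₁` (i.e.
`[V(K')^σ : N V(K')] = 1`, the conclusion of Kramer–Tunnell Lemma 6.1 / Mazur's norm theorem / Kramer Props. 1–2 (a) in the
tree's currency), then every `Γ_F`-fixed geometric point `P` is `Q + τ₀Q` with `Q` fixed by `Gal(F̄/K')`: descend `P` to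
`P₀ ∈ V(F)` (Silverman VIII.§1), base-change to `K'` (a `σ`-fixed point), write it as `Q₁ + σQ₁`, and push `Q₁` to `F̄`.
[cite: KramerTunnell1982, §5 proof of Prop. 5.11 (p. 326), E(F)/NE(K) ≅ Ĥ⁰(G, E(K))] [cite: SilvermanAEC2009, VIII.§1] -/
theorem exists_fixed_norm_eq_of_fixedSubgroup_le_normSubgroup [PerfectField F] (σ : K' ≃ₐ[F] K')
    (hle : fixedSubgroup V K' σ ≤ normSubgroup V K' σ) {τ₀ : absoluteGaloisGroup F}
    (hτ₀ : ∀ x : K', (show AlgebraicClosure F ≃ₐ[F] AlgebraicClosure F from τ₀) (x : AlgebraicClosure F) =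
      ((σ x : K') : AlgebraicClosure F))
    {P : geomPoints V} (hP : P ∈ MulAction.fixedPoints (absoluteGaloisGroup F) (geomPoints V)) :
    ∃ Q : geomPoints V,
      (∀ g : absoluteGaloisGroup F,
        (∀ x : K', (show AlgebraicClosure F ≃ₐ[F] AlgebraicClosure F from g) (x : AlgebraicClosure F) = x) → g • Q = Q) ∧
      Q + τ₀ • Q = P := by
  -- descent to `V(F)`
  obtain ⟨P₀, rfl⟩ := exists_toGeomPoints_eq_of_forall_smul_eq V (Q := P) hP
  -- the base change to `K'` is `σ`-fixed, hence a norm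
  have hfix : Affine.Point.baseChange (W' := V) F K' P₀ ∈ fixedSubgroup V K' σ :=
    mem_fixedSubgroup_iff.mpr (Affine.Point.map_baseChange (W' := V) (σ : K' →ₐ[F] K') P₀)
  obtain ⟨Q₁, hQ₁⟩ := mem_normSubgroup_iff.mp (hle hfix)
  refine ⟨(Affine.Point.map (W' := V) (IntermediateField.val K') Q₁ : geomPoints V),
    fun g hg ↦ smul_map_val_eq_self_of_forall_apply V K' g hg Q₁, ?_⟩
  change Affine.Point.map (W' := V) (IntermediateField.val K') Q₁ +
      Affine.Point.map (W' := V)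
        ((show AlgebraicClosure F ≃ₐ[F] AlgebraicClosure F from τ₀) : AlgebraicClosure F →ₐ[F] AlgebraicClosure F)
        (Affine.Point.map (W' := V) (IntermediateField.val K') Q₁) = toGeomPoints V P₀
  rw [smul_map_val_eq_of_forall_apply V K' τ₀ σ hτ₀ Q₁, ← map_add, hQ₁, map_val_baseChange_eq_toGeomPoints]

end Field

/-! ## §88 The series' currency: `W(K̄_E)`, `α = closureEmb E (geomSqrt d)`, `K' = (IntermediateField.adjoin E {α})` -/

section Local

variable {K : Type u} [Field K] (W : WeierstrassCurve K) {d : K} (E : Type u) [Field E] [Algebra K E]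

omit W in
/-- `α = ι√d` is integral over `E` (`α² = d`). [folklore] -/
theorem isIntegral_closureEmb_geomSqrt : IsIntegral E (closureEmb (K := K) E (geomSqrt d)) :=
  Algebra.IsIntegral.isIntegral _

omit W in
/-- **An `E`-algebra map out of `(IntermediateField.adjoin E {α})` is determined by its value at `α`** (power basis of a simple algebraic extension):
if `g ∈ Γ_E` fixes `α = ι√d`, then `g` is the identity on `(IntermediateField.adjoin E {α})`. [folklore] -/
theorem forall_apply_eq_of_apply_adjoin_gen_eq (g : absoluteGaloisGroup E)
    (hg : (show AlgebraicClosure E ≃ₐ[E] AlgebraicClosure E from g) (closureEmb (K := K) E (geomSqrt d)) =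
      closureEmb (K := K) E (geomSqrt d))
    (x : (IntermediateField.adjoin E {closureEmb (K := K) E (geomSqrt d)})) :
    (show AlgebraicClosure E ≃ₐ[E] AlgebraicClosure E from g) (x : AlgebraicClosure E) = x := by
  have key : ((show AlgebraicClosure E ≃ₐ[E] AlgebraicClosure E from g) : AlgebraicClosure E →ₐ[E] AlgebraicClosure E).comp
      (IntermediateField.val (IntermediateField.adjoin E {closureEmb (K := K) E (geomSqrt d)})) =
      IntermediateField.val (IntermediateField.adjoin E {closureEmb (K := K) E (geomSqrt d)}) := by
    refine (IntermediateField.adjoin.powerBasis (isIntegral_closureEmb_geomSqrt (d := d) E)).algHom_ext ?_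
    rw [IntermediateField.adjoin.powerBasis_gen]
    change (show AlgebraicClosure E ≃ₐ[E] AlgebraicClosure E from g)
      ((IntermediateField.AdjoinSimple.gen E (closureEmb (K := K) E (geomSqrt d)) :
        (IntermediateField.adjoin E {closureEmb (K := K) E (geomSqrt d)})) : AlgebraicClosure E) = _
    rw [IntermediateField.AdjoinSimple.coe_gen]
    exact hg
  have h := congrArg (fun f : (IntermediateField.adjoin E {closureEmb (K := K) E (geomSqrt d)}) →ₐ[E]
    AlgebraicClosure E ↦ f x) key
  exact h

omit W in
/-- **An `E`-algebra map out of `(IntermediateField.adjoin E {α})` is determined by its value at `α`:** if `τ₀ ∈ Γ_E` and `σ ∈ Aut((IntermediateField.adjoin E {α})/E)` agree at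
`α = ι√d` then `τ₀` restricts to `σ` on `(IntermediateField.adjoin E {α})`. [folklore] -/
theorem forall_apply_eq_of_apply_adjoin_gen_eq_apply (τ₀ : absoluteGaloisGroup E)
    (σ : (IntermediateField.adjoin E {closureEmb (K := K) E (geomSqrt d)}) ≃ₐ[E] (IntermediateField.adjoin E {closureEmb (K := K) E (geomSqrt d)}))
    (h : (show AlgebraicClosure E ≃ₐ[E] AlgebraicClosure E from τ₀) (closureEmb (K := K) E (geomSqrt d)) =
      ((σ (IntermediateField.AdjoinSimple.gen E (closureEmb (K := K) E (geomSqrt d))) :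
        (IntermediateField.adjoin E {closureEmb (K := K) E (geomSqrt d)})) : AlgebraicClosure E))
    (x : (IntermediateField.adjoin E {closureEmb (K := K) E (geomSqrt d)})) :
    (show AlgebraicClosure E ≃ₐ[E] AlgebraicClosure E from τ₀) (x : AlgebraicClosure E) =
      ((σ x : (IntermediateField.adjoin E {closureEmb (K := K) E (geomSqrt d)})) : AlgebraicClosure E) := by
  have key : ((show AlgebraicClosure E ≃ₐ[E] AlgebraicClosure E from τ₀) : AlgebraicClosure E →ₐ[E] AlgebraicClosure E).comp
      (IntermediateField.val (IntermediateField.adjoin E {closureEmb (K := K) E (geomSqrt d)})) =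
      (IntermediateField.val (IntermediateField.adjoin E {closureEmb (K := K) E (geomSqrt d)})).comp
        (σ : (IntermediateField.adjoin E {closureEmb (K := K) E (geomSqrt d)}) →ₐ[E]
          (IntermediateField.adjoin E {closureEmb (K := K) E (geomSqrt d)})) := by
    refine (IntermediateField.adjoin.powerBasis (isIntegral_closureEmb_geomSqrt (d := d) E)).algHom_ext ?_
    rw [IntermediateField.adjoin.powerBasis_gen]
    change (show AlgebraicClosure E ≃ₐ[E] AlgebraicClosure E from τ₀)
      ((IntermediateField.AdjoinSimple.gen E (closureEmb (K := K) E (geomSqrt d)) :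
        (IntermediateField.adjoin E {closureEmb (K := K) E (geomSqrt d)})) : AlgebraicClosure E) =
      ((σ (IntermediateField.AdjoinSimple.gen E (closureEmb (K := K) E (geomSqrt d))) :
        (IntermediateField.adjoin E {closureEmb (K := K) E (geomSqrt d)})) : AlgebraicClosure E)
    rw [IntermediateField.AdjoinSimple.coe_gen]
    exact h
  have h' := congrArg (fun f : (IntermediateField.adjoin E {closureEmb (K := K) E (geomSqrt d)}) →ₐ[E]
    AlgebraicClosure E ↦ f x) key
  exact h'

/-- **THE BRIDGE: `hnorm` from `[E(K')^σ : N E(K')] = 1`.** `W/K` any Weierstrass curve over a field `K`, `E` a perfect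
`K`-field (a completion `K_v`), `α = ι√d ∈ K̄_E`, `K' = (IntermediateField.adjoin E {α})`, `σ ∈ Aut(K'/E)` with `σ α = −α`, `τ₀ ∈ Γ_E` with `τ₀ α = −α`.
IF `fixedSubgroup (W ⊗ E) K' σ ≤ normSubgroup (W ⊗ E) K' σ` (relative index `1`: the tree's Kramer–Tunnell / Mazur / Kramer
norm theorems), THEN the engine's displayed `hnorm` holds: every `Γ_E`-fixed point of `W(K̄_E) = localPoints W E` is `Q + τ₀Q`
with `Q` fixed by every `g ∈ Γ_E` fixing `α`. (§87 on `V = W ⊗ E`, transported along the `Γ_E`-equivariant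
`baseChangeGeomPointsEquiv : (W ⊗ E)(Ē) ≃+ W(K̄_E)`.) [cite: MazurRubin2010, Lemma 2.9 and proof of Lemma 2.10 («E_N(K_v) = E(K_v)»)]
[cite: KramerTunnell1982, §5 proof of Prop. 5.11 (p. 326)] -/
theorem forall_exists_norm_of_fixedSubgroup_le_normSubgroup [PerfectField E]
    (σ : (IntermediateField.adjoin E {closureEmb (K := K) E (geomSqrt d)}) ≃ₐ[E] (IntermediateField.adjoin E {closureEmb (K := K) E (geomSqrt d)}))
    (hσ : ((σ (IntermediateField.AdjoinSimple.gen E (closureEmb (K := K) E (geomSqrt d))) :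
        (IntermediateField.adjoin E {closureEmb (K := K) E (geomSqrt d)})) : AlgebraicClosure E) = -closureEmb (K := K) E (geomSqrt d))
    (hle : fixedSubgroup (W.baseChange E) ((IntermediateField.adjoin E {closureEmb (K := K) E (geomSqrt d)})) σ ≤
      normSubgroup (W.baseChange E) ((IntermediateField.adjoin E {closureEmb (K := K) E (geomSqrt d)})) σ)
    {τ₀ : absoluteGaloisGroup E}
    (hτ₀ : (show AlgebraicClosure E ≃ₐ[E] AlgebraicClosure E from τ₀) (closureEmb (K := K) E (geomSqrt d)) =
      -closureEmb (K := K) E (geomSqrt d)) :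
    ∀ P ∈ MulAction.fixedPoints (absoluteGaloisGroup E) (localPoints W E),
      ∃ Q : localPoints W E,
        (∀ g : absoluteGaloisGroup E,
          (show AlgebraicClosure E ≃ₐ[E] AlgebraicClosure E from g) (closureEmb (K := K) E (geomSqrt d)) =
              closureEmb (K := K) E (geomSqrt d) →
            g • Q = Q) ∧ Q + τ₀ • Q = P := by
  intro P hP
  set e := W.baseChangeGeomPointsEquiv E with he
  -- transport `P` to the geometric points of `W ⊗ E`
  have hP' : e.symm P ∈ MulAction.fixedPoints (absoluteGaloisGroup E) (geomPoints (W.baseChange E)) := fun g ↦ by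
    rw [← W.baseChangeGeomPointsEquiv_symm_smul E g P, hP g]
  have hτ₀' := forall_apply_eq_of_apply_adjoin_gen_eq_apply (d := d) E τ₀ σ (hτ₀.trans hσ.symm)
  obtain ⟨Q', hQ'fix, hQ'⟩ := exists_fixed_norm_eq_of_fixedSubgroup_le_normSubgroup (W.baseChange E)
    ((IntermediateField.adjoin E {closureEmb (K := K) E (geomSqrt d)})) σ hle hτ₀' hP'
  refine ⟨e Q', fun g hg ↦ ?_, ?_⟩
  · rw [← W.baseChangeGeomPointsEquiv_smul E g Q',
      hQ'fix g (forall_apply_eq_of_apply_adjoin_gen_eq (d := d) E g hg)]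
  · rw [← W.baseChangeGeomPointsEquiv_smul E τ₀ Q', ← map_add, hQ', he, AddEquiv.apply_symm_apply]

end Local

end Summit.BirchSwinnertonDyer.BirchSwinnertonDyer.Theorems.GenusKolyArch

end
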